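import Summits.BirchSwinnertonDyer.Rank1Residual.P2.KrizLiCubicAThreeSlices
import Summits.BirchSwinnertonDyer.Rank1Residual.X11b.KrausMinimalityGeneralTwo
import Literature.NumberTheory.EllipticCurves.Rank1Residual.X11RankOneCertificates.Minimality
import HarnessLib

/-!
# Cell `bsd-print-cf2` (D-0131 (2) PRINT TIER, leaf CornerF @ `p = 2`), typer ty2 — the MINIMAL MODEL OF A
# KRIZ–LI TWIST ON THE NOSE, generic part: `E_a^{(d)} ≅ y² + y = x³ + k` (`4k + 1 = d³(4a + 1)`) and
# `(y² = x³ + B)^{(d)} = y² = x³ + d³B` are GLOBALLY MINIMAL for the `d` of Kriz–Li's index set `𝒩`, and every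
# globally minimal MODEL of `E^{(d)}` carries `ord_{s=1} L = 1 ∧ BSD(·, 2)` BY NAME

HONEST FRAMING (cell `bsd-print-cf2`, run/shared/lean/pub/bsd-print-cf2/; verbatim): PARTITION currency only
— the leaf `Summit.BirchSwinnertonDyer.WAllCornerFTwo` counts when its class theorem is in the kernel BY NAME;
every imported theorem carries its printed hypotheses verbatim. The leaf and crux `InertJZeroOfFacts`
(stmt-BirchSwinnertonDyer-20671) are OPEN AS CLASSES; nothing class-wide is closed here; THEOREMS ONLY — no
definition, no named fact; Assumption (★) is never stated here (it is the displayed binder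
`hSD : P2.HasKrizLiStarDatum E K`, a certificate at every base other than `243a1`).

WHAT THIS FILE IS FOR. The Kriz–Li door (Kriz–Li 2019 Thm 5.1 (2) = arXiv Thm 1.12, tree fact
`KrizLi2019.thm112_bsdTwo_twist`; aside 21366 CLOSED by p3's transport `P2/KrizLiSmallCMBase*`) is consumed in
the tree on ISOGENY CLASSES ("every globally minimal `W'` `ℚ`-isogenous to `E^{(d)}`"). The certificate seat
ty3 displays RECORDS whose `ainvs` are a concrete minimal model of the rank-one member `E^{(d)}` (schema
`Literature/…/CornerFTwoCertificates/KrizLiSchema.lean`: "`ainvs` — a global minimal model of `E^{(d)}`;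
for `243a1`: `[0, 0, 1, 0, (−3d³−1)/4]`, rechecked as `4·a₆ + 1 = −3d³`"), and its Summits-side glue needs
per base two kernel facts about that model — it IS a model of `E^{(d)}`, it IS globally minimal — proved ad hoc
for the printed fibre `243a1` in `P2/CornerFTwoCertificatesKrizLi` (`isGloballyMinimal_model243`). Here they
are proved ONCE for the two shapes of the nine (★)-certified `j = 0` bases (lit dossier §14.4); the companions
`P2/KrizLiTwistMinimalModelsGoodBases.lean` (`1323a1, 1323m1, 4563a1, 4563b1`) and
`P2/KrizLiTwistMinimalModelsAdditiveBases.lean` (`972d1, 1728a1, 1728v1, 3888s1`) instantiate: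

* §1 a PER-PRIME global-minimality criterion for an integer model over `ℚ`: Silverman's disjuncts
  `q¹² ∤ Δ ∨ q⁴ ∤ c₄` at each prime, or, at `q = 2`, the integer Kraus test of the tree's
  `X11b.isMinimalAt_two_of_kraus_violated` — the tree's `isGloballyMinimal_of_int_criterion` (Silverman only)
  and `X11b.isGloballyMinimal_of_krausCriterion_support` (exact support of `Δ`, a numeral) do not cover a
  SYMBOLIC twist parameter `d` at a base with `ord₂ Δ = 12` (`3888s1`);
* §2 the arithmetic of twisting: `q¹² ∤ c·(d³t)²` for `d` square-free with every prime of `d` prime to `c·t`,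
  granted `q¹² ∤ c·t²`; finite checks (`q¹² ∤ N` from the primes `q ≤ r`, `N < (r+1)¹²`; primes of
  `d ≡ 1 (mod 12)` are `≠ 2, 3`) used by the per-base files;
* §3 shape `E_a = y² + y = x³ + a` (ty2 g3 `P2.cubicA₃`; `Δ = −27(4a+1)²`, `c₄ = 0`): `E_k` is globally minimal
  when `q¹² ∤ 27(4k+1)²` for all `q`; so is the twist model `E_k`, `4k + 1 = d³(4a + 1)`
  (`P2.smul_quadraticTwist_cubicA₃_eq`), for `d` square-free prime to `27(4a+1)`, granted the base criterion;
* §4 shape `y² = x³ + B` (`Δ = −432B²`, `c₄ = 0`, `c₆ = −864B`): `y² = x³ + m` is globally minimal when, at each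
  prime, `q¹² ∤ 432m²` or (`q = 2`) `m = 16w`, `w ≡ 3 (mod 4)` (Kraus); the twist is `y² = x³ + d³B` on the nose
  (tree `quadraticTwist_mk_a₆`), globally minimal for `d` square-free prime to `6B` granted the base criterion,
  and — for `B = 16u`, `u ≡ 3 (mod 4)`, `d ≡ 1 (mod 4)` — by Kraus at `2`;
* §5 THE CONCLUSION ON THE NOSE, `E`-generic: for a small-conductor CM base `E` with a (★)-datum over a
  Heegner field `K` and `d ∈ 𝒩(E, K)`, `χ_d(−N) = 1`, every globally minimal `W₁` with `C • E^{(d)} = W₁` has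
  `ord_{s=1} L(W₁, s) = 1 ∧ BSD(W₁, 2)`, granted BY NAME the seven facts `hKL h33 hS31 hBF hmod hGZK hCassels`
  of p3's transport (the rank-zero partner enters through an abstract minimal model,
  `P2.exists_globallyMinimal_twist`); and the `a`-generic form for the model `E_k` of `E_a^{(d)}`.

Currency: LITERAL-by-name((★)-display) as in ty2 g3's membership files; beyond-print theorem: NO (discharge
interface). References: [KrizLi2019] Thm 5.1 (2) = arXiv:1606.03172 Thm 1.12, Def 4.1, Thm 4.3, §6 Ex. 6.2;
[SilvermanAEC2009] VII.1 Remark 1.1, VIII.8, X.5 Prop. 5.4; [Kraus1989] Prop. 2; [CreutzMiller2012] Thm 1.1;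
[BurungaleFlach2024] Thm 1.1, Cor. 2; [MilneADT2006] Thm I.7.3; cell dossier §14.4; tree `P2/KrizLiJZeroSetting`,
`P2/KrizLiMordellAtTwo` (ty2 g3), `P2/KrizLiSmallCMBase*`, `P2/KrizLiCubicAThreeSlices` (p3),
`X11b/KrausMinimalityGeneralTwo`, `Literature/…/X11RankOneCertificates/Minimality`,
`Literature/…/CornerFTwoCertificates/KrizLiSchema` (ty3).
-/

noncomputable section

open scoped Classical

open IsDedekindDomain NumberField Rat.HeightOneSpectrum WeierstrassCurve
  Literature.NumberTheory.EllipticCurves Literature.NumberTheory.EllipticCurves.Rank1Residual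
  Literature.NumberTheory.EllipticCurves.ModularForms
  Literature.NumberTheory.EllipticCurves.Rank1Residual.X11RankOneCertificates
  Literature.NumberTheory.GaloisRepresentations Literature.NumberTheory.DiophantineGeometry
  Summit.BirchSwinnertonDyer.Rank1Residual

set_option autoImplicit false

namespace Summit.BirchSwinnertonDyer.Rank1Residual.P2

/-! ## §1 A per-prime global-minimality criterion for an integer model: Silverman, or Kraus at `2` -/

/-- **Global minimality of an integer model `[a₁,…,a₆]` over `ℚ` from a PER-PRIME test**: at every prime
`q`, Silverman's disjuncts `q¹² ∤ Δ ∨ q⁴ ∤ c₄` (AEC VII.1 Rem. 1.1), or `q = 2`, `c₄ = 16x`, `c₆ = 64y` with the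
integer Kraus test `¬((16 ∣ x ∧ (32 ∣ y ∨ 32 ∣ y − 8)) ∨ 4 ∣ y + 1)` of the tree's
`X11b.isMinimalAt_two_of_kraus_violated` (Kraus 1989 Prop. 2: then no `2`-adic descent exists). The per-prime
form of the tree's `X11b.isGloballyMinimal_of_krausCriterion_support` (which asks for the exact support of
`Δ`) and of `isGloballyMinimal_of_int_criterion` (Silverman only), usable with a symbolic `a₆`.
[cite: SilvermanAEC2009, VII.1 Remark 1.1 and VIII.8] [cite: Kraus1989, Prop. 2] -/
theorem isGloballyMinimal_of_int_criterion_or_kraus_two (a1 a2 a3 a4 a6 : ℤ)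
    (h : ∀ q : ℕ, q.Prime →
      (¬ (q : ℤ) ^ 12 ∣ discOf [a1, a2, a3, a4, a6] ∨ ¬ (q : ℤ) ^ 4 ∣ c4Of [a1, a2, a3, a4, a6]) ∨
      (q = 2 ∧ ∃ x y : ℤ, c4Of [a1, a2, a3, a4, a6] = 16 * x ∧ c6Of [a1, a2, a3, a4, a6] = 64 * y ∧
        ¬ (((16 : ℤ) ∣ x ∧ ((32 : ℤ) ∣ y ∨ (32 : ℤ) ∣ y - 8)) ∨ (4 : ℤ) ∣ y + 1))) :
    (⟨a1, a2, a3, a4, a6⟩ : WeierstrassCurve ℚ).IsGloballyMinimal where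
  isIntegral := isIntegral_of_exists_lift (𝓞 ℚ) ⟨(a1 : 𝓞 ℚ), by simp⟩ ⟨(a2 : 𝓞 ℚ), by simp⟩
    ⟨(a3 : 𝓞 ℚ), by simp⟩ ⟨(a4 : 𝓞 ℚ), by simp⟩ ⟨(a6 : 𝓞 ℚ), by simp⟩
  isMinimal v := by
    set W : WeierstrassCurve ℚ := ⟨a1, a2, a3, a4, a6⟩ with hW
    have hle : ∀ m : ℤ, v.valuation ℚ (m : ℚ) ≤ 1 := fun m ↦ by
      have hm : (m : ℚ) = algebraMap (𝓞 ℚ) ℚ (m : 𝓞 ℚ) := by simp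
      rw [hm]
      exact v.valuation_le_one _
    have hint : W.IsIntegralAt v :=
      W.isIntegralAt_of_valuation_le_one v (hle a1) (hle a2) (hle a3) (hle a4) (hle a6)
    have hΔ : W.Δ = ((discOf [a1, a2, a3, a4, a6] : ℤ) : ℚ) := by
      simp only [hW, WeierstrassCurve.Δ, WeierstrassCurve.b₂, WeierstrassCurve.b₄, WeierstrassCurve.b₆,
        WeierstrassCurve.b₈, discOf, invariants]
      push_cast
      ring
    have hc4 : W.c₄ = ((c4Of [a1, a2, a3, a4, a6] : ℤ) : ℚ) := by
      simp only [hW, WeierstrassCurve.c₄, WeierstrassCurve.b₂, WeierstrassCurve.b₄, c4Of, invariants]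
      push_cast
      ring
    have hc6 : W.c₆ = ((c6Of [a1, a2, a3, a4, a6] : ℤ) : ℚ) := by
      simp only [hW, WeierstrassCurve.c₆, WeierstrassCurve.b₂, WeierstrassCurve.b₄, WeierstrassCurve.b₆,
        c6Of, invariants]
      push_cast
      ring
    set q := natGenerator v with hq
    have hqp : q.Prime := prime_natGenerator v
    rcases h q hqp with (h12 | h4) | ⟨h2, x, y, hx, hy, hk⟩
    · exact isMinimalAt_of_lt_valuation_Δ_holds hint
        (by rw [hΔ]; exact exp_neg_lt_valuation_intCast_of_not_pow_dvd v (by rw [← hq]; exact h12))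
    · exact isMinimalAt_of_lt_valuation_c₄ hint
        (by rw [hc4]; exact exp_neg_lt_valuation_intCast_of_not_pow_dvd v (by rw [← hq]; exact h4))
    · have hv2 : natGenerator v = 2 := by rw [← hq, h2]
      refine X11b.isMinimalAt_two_of_kraus_violated v W hv2 hint (x := x) (y := y) ?_ ?_ hk
      · rw [hc4, hx]; push_cast; ring
      · rw [hc6, hy]; push_cast; ring

/-! ## §2 The arithmetic of twisting a `12`-th-power-free quantity by `d³`, `d` square-free -/

/-- `(q : ℤ)ᵏ ∣ z ⟺ qᵏ ∣ |z|`. [folklore] -/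
theorem intCast_pow_dvd_iff_pow_dvd_natAbs {q k : ℕ} {z : ℤ} : (q : ℤ) ^ k ∣ z ↔ q ^ k ∣ z.natAbs := by
  rw [← Nat.cast_pow]
  exact Int.natCast_dvd

/-- **Twisting keeps Silverman's criterion**: if `d` is square-free, every prime of `d` is prime to `c·t`,
and `q¹² ∤ c·t²`, then `q¹² ∤ c·(d³t)² = (c·t²)·d⁶` (a prime `q ∣ d` sees `q⁶` exactly; a prime `q ∤ d` sees
the base). [cite: SilvermanAEC2009, VII.1 Remark 1.1 and X.5 Prop. 5.4] -/
theorem not_pow_twelve_dvd_mul_sq_twist {c t d : ℤ} (hsq : Squarefree d.natAbs) {q : ℕ} (hq : q.Prime)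
    (hcop : q ∣ d.natAbs → ¬ q ∣ (c * t).natAbs) (hbase : ¬ (q : ℤ) ^ 12 ∣ c * t ^ 2) :
    ¬ (q : ℤ) ^ 12 ∣ c * (d ^ 3 * t) ^ 2 := by
  intro h
  have h' : q ^ 12 ∣ (c * t ^ 2).natAbs * d.natAbs ^ 6 := by
    have h1 := intCast_pow_dvd_iff_pow_dvd_natAbs.mp h
    rwa [show c * (d ^ 3 * t) ^ 2 = (c * t ^ 2) * d ^ 6 by ring, Int.natAbs_mul, Int.natAbs_pow] at h1
  have hbase' : ¬ q ^ 12 ∣ (c * t ^ 2).natAbs := fun hd => hbase (intCast_pow_dvd_iff_pow_dvd_natAbs.mpr hd)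
  by_cases hqd : q ∣ d.natAbs
  · have hct : ¬ q ∣ (c * t ^ 2).natAbs := fun h2 => by
      rw [Int.natAbs_mul, Int.natAbs_pow] at h2
      rcases (Nat.Prime.dvd_mul hq).mp h2 with hc | ht
      · exact hcop hqd (by rw [Int.natAbs_mul]; exact dvd_mul_of_dvd_left hc _)
      · exact hcop hqd (by rw [Int.natAbs_mul]; exact dvd_mul_of_dvd_right (hq.dvd_of_dvd_pow ht) _)
    have hco : Nat.Coprime (q ^ 12) (c * t ^ 2).natAbs :=
      Nat.Coprime.pow_left 12 ((Nat.Prime.coprime_iff_not_dvd hq).mpr hct)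
    have h6 : q ^ 12 ∣ d.natAbs ^ 6 := hco.dvd_of_dvd_mul_left h'
    have h2 : q ^ 2 ∣ d.natAbs := by
      rw [show q ^ 12 = (q ^ 2) ^ 6 by ring] at h6
      exact (Nat.pow_dvd_pow_iff (by norm_num)).mp h6
    have hu : IsUnit q := hsq q (by rw [← sq]; exact h2)
    exact hq.one_lt.ne' (Nat.isUnit_iff.mp hu)
  · have hco : Nat.Coprime (q ^ 12) (d.natAbs ^ 6) :=
      Nat.Coprime.pow 12 6 ((Nat.Prime.coprime_iff_not_dvd hq).mpr hqd)
    exact hbase' (hco.dvd_of_dvd_mul_right h')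

/-- A prime dividing `p₁ⁱ · p₂ʲ` (`p₁, p₂` prime) is `p₁` or `p₂`. [folklore] -/
theorem eq_or_eq_of_prime_dvd_pow_mul_pow {ℓ p₁ p₂ i j : ℕ} (hℓ : ℓ.Prime) (h₁ : p₁.Prime) (h₂ : p₂.Prime)
    (h : ℓ ∣ p₁ ^ i * p₂ ^ j) : ℓ = p₁ ∨ ℓ = p₂ := by
  rcases (Nat.Prime.dvd_mul hℓ).mp h with h | h
  · exact Or.inl ((Nat.prime_dvd_prime_iff_eq hℓ h₁).mp (hℓ.dvd_of_dvd_pow h))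
  · exact Or.inr ((Nat.prime_dvd_prime_iff_eq hℓ h₂).mp (hℓ.dvd_of_dvd_pow h))

/-- The primes of `d ≡ 1 (mod 12)` are neither `2` nor `3`. [folklore] -/
theorem ne_two_and_ne_three_of_dvd_of_emod_twelve {d : ℤ} (hd12 : d % 12 = 1) {q : ℕ} (hqd : q ∣ d.natAbs) :
    q ≠ 2 ∧ q ≠ 3 := by
  have hqd' : (q : ℤ) ∣ d := Int.natCast_dvd.mpr hqd
  constructor
  · rintro rfl
    obtain ⟨m, hm⟩ := hqd'
    omega
  · rintro rfl
    obtain ⟨m, hm⟩ := hqd'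
    omega

/-! ### Finite checks used per base (`P2/KrizLiTwistMinimalModels{Good,Additive}Bases.lean`) -/


/-- `q¹² ∤ N` for every prime `q`, once `0 < N < (r+1)¹²` and no prime `q ≤ r` has `q¹² ∣ N` (the finite check).
[folklore] -/
theorem not_pow_twelve_dvd_of_lt_pow {N r : ℕ} (hN : 0 < N) (hr : N < (r + 1) ^ 12)
    (h : ∀ q : ℕ, q.Prime → q ≤ r → ¬ q ^ 12 ∣ N) {q : ℕ} (hq : q.Prime) : ¬ q ^ 12 ∣ N := fun hd => by
  have hle : q ^ 12 ≤ N := Nat.le_of_dvd hN hd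
  by_cases hqr : q ≤ r
  · exact h q hq hqr hd
  · have : (r + 1) ^ 12 ≤ q ^ 12 := Nat.pow_le_pow_left (by omega) 12
    omega

/-- Integer form: `q¹² ∤ z` for every prime `q` from the finite check on `|z| = N`. [folklore] -/
theorem not_intCast_pow_twelve_dvd_of_natAbs_eq {z : ℤ} (N r : ℕ) (hz : z.natAbs = N) (hN : 0 < N)
    (hr : N < (r + 1) ^ 12) (h : ∀ q : ℕ, q.Prime → q ≤ r → ¬ q ^ 12 ∣ N) :
    ∀ q : ℕ, q.Prime → ¬ (q : ℤ) ^ 12 ∣ z := fun _ hq hd =>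
  not_pow_twelve_dvd_of_lt_pow hN hr h hq (hz ▸ intCast_pow_dvd_iff_pow_dvd_natAbs.mp hd)

/-- For `d ≡ 1 (mod 12)` with `p ∤ d`, no prime of `d` divides `27t` when `|27t| = 3³·pʲ`. [folklore] -/
theorem not_dvd_of_natAbs_eq_pow_three_mul_pow {d : ℤ} (hd12 : d % 12 = 1) {p : ℕ} (hp : p.Prime)
    (hpd : ¬ (p : ℤ) ∣ d) {t : ℤ} {j : ℕ} (ht : (27 * t).natAbs = 3 ^ 3 * p ^ j) :
    ∀ q : ℕ, q.Prime → q ∣ d.natAbs → ¬ q ∣ (27 * t).natAbs := by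
  intro q hq hqd h
  rw [ht] at h
  rcases eq_or_eq_of_prime_dvd_pow_mul_pow hq Nat.prime_three hp h with rfl | rfl
  · exact (ne_two_and_ne_three_of_dvd_of_emod_twelve hd12 hqd).2 rfl
  · exact hpd (Int.natCast_dvd.mpr hqd)

/-- For `d ≡ 1 (mod 12)`, no prime of `d` divides `432B` when `|432B| = 2ⁱ·3ʲ`. [folklore] -/
theorem not_dvd_of_natAbs_eq_pow_two_mul_pow_three {d : ℤ} (hd12 : d % 12 = 1) {B : ℤ} {i j : ℕ}
    (hB : (432 * B).natAbs = 2 ^ i * 3 ^ j) :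
    ∀ q : ℕ, q.Prime → q ∣ d.natAbs → ¬ q ∣ (432 * B).natAbs := by
  intro q hq hqd h
  rw [hB] at h
  obtain ⟨h2, h3⟩ := ne_two_and_ne_three_of_dvd_of_emod_twelve hd12 hqd
  rcases eq_or_eq_of_prime_dvd_pow_mul_pow hq Nat.prime_two Nat.prime_three h with rfl | rfl
  · exact h2 rfl
  · exact h3 rfl

/-! ## §3 Shape `E_a : y² + y = x³ + a` — the twist model `E_k`, `4k + 1 = d³(4a + 1)`, is globally minimal -/

/-- **`E_k = [0,0,1,0,k]` is globally minimal as soon as `q¹² ∤ 27(4k+1)²` for every prime `q`**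
(`Δ(E_k) = −27(4k+1)²`, `c₄ = 0`: Silverman's criterion). [cite: SilvermanAEC2009, VII.1 Remark 1.1 and VIII.8] -/
theorem isGloballyMinimal_cubicA₃_of_not_pow_twelve_dvd (k : ℤ)
    (h : ∀ q : ℕ, q.Prime → ¬ (q : ℤ) ^ 12 ∣ 27 * (4 * k + 1) ^ 2) : (cubicA₃ k).IsGloballyMinimal := by
  rw [cubicA₃_eq k]
  refine isGloballyMinimal_of_int_criterion 0 0 1 0 k fun q hq hand => h q hq ?_
  have hΔ : discOf [0, 0, 1, 0, k] = -(27 * (4 * k + 1) ^ 2) := by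
    simp only [discOf, invariants]; ring
  have h1 := hand.1
  rw [hΔ, dvd_neg] at h1
  exact h1

/-- **The twist model `E_k ≅ E_a^{(d)}` (`4k + 1 = d³(4a+1)`, `P2.smul_quadraticTwist_cubicA₃_eq`) is globally
minimal** for `d` square-free with every prime of `d` prime to `27(4a+1)`, granted the base criterion
`q¹² ∤ 27(4a+1)²` (then `Δ(E_k) = −27(4a+1)²·d⁶`). [cite: SilvermanAEC2009, VII.1 Remark 1.1 and X.5 Prop. 5.4] -/
theorem isGloballyMinimal_cubicA₃_twist (a : ℤ) {d k : ℤ} (hk : 4 * k + 1 = d ^ 3 * (4 * a + 1))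
    (hsq : Squarefree d.natAbs) (hcop : ∀ q : ℕ, q.Prime → q ∣ d.natAbs → ¬ q ∣ (27 * (4 * a + 1)).natAbs)
    (hbase : ∀ q : ℕ, q.Prime → ¬ (q : ℤ) ^ 12 ∣ 27 * (4 * a + 1) ^ 2) : (cubicA₃ k).IsGloballyMinimal :=
  isGloballyMinimal_cubicA₃_of_not_pow_twelve_dvd k fun q hq => by
    rw [hk]
    exact not_pow_twelve_dvd_mul_sq_twist hsq hq (hcop q hq) (hbase q hq)

/-! ## §4 Shape `y² = x³ + B` — the twist model `y² = x³ + d³B` is globally minimal -/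

/-- **`y² = x³ + m` (`m ∈ ℤ`) is globally minimal as soon as, at every prime `q`, `q¹² ∤ 432m²`, or `q = 2` and
`m = 16w` with `w ≡ 3 (mod 4)`** (`Δ = −432m²`, `c₄ = 0`, `c₆ = −864m = 64·(−216w)`; Kraus's test at `2`:
`32 ∤ −216w`, `32 ∤ −216w − 8 = −8(27w + 1)` as `27w + 1 ≡ 2 (mod 4)`, `4 ∤ −216w + 1`).
[cite: SilvermanAEC2009, VII.1 Remark 1.1 and VIII.8] [cite: Kraus1989, Prop. 2] -/
theorem isGloballyMinimal_sextic_of_criterion (m : ℤ)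
    (h : ∀ q : ℕ, q.Prime → ¬ (q : ℤ) ^ 12 ∣ 432 * m ^ 2 ∨ (q = 2 ∧ ∃ w : ℤ, m = 16 * w ∧ w % 4 = 3)) :
    (⟨0, 0, 0, 0, (m : ℚ)⟩ : WeierstrassCurve ℚ).IsGloballyMinimal := by
  have e : (⟨0, 0, 0, 0, (m : ℚ)⟩ : WeierstrassCurve ℚ) =
      ⟨((0 : ℤ) : ℚ), ((0 : ℤ) : ℚ), ((0 : ℤ) : ℚ), ((0 : ℤ) : ℚ), (m : ℚ)⟩ := by
    push_cast; rfl
  rw [e]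
  refine isGloballyMinimal_of_int_criterion_or_kraus_two 0 0 0 0 m fun q hq => ?_
  have hΔ : discOf [0, 0, 0, 0, m] = -(432 * m ^ 2) := by simp only [discOf, invariants]; ring
  have hc4 : c4Of [0, 0, 0, 0, m] = 0 := by simp only [c4Of, invariants]; ring
  have hc6 : c6Of [0, 0, 0, 0, m] = -(864 * m) := by simp only [c6Of, invariants]; ring
  rcases h q hq with h12 | ⟨h2, w, hw, hw4⟩
  · refine Or.inl (Or.inl fun hd => h12 ?_)
    rw [hΔ, dvd_neg] at hd
    exact hd
  · refine Or.inr ⟨h2, 0, -(216 * w), by rw [hc4]; ring, by rw [hc6, hw]; ring, ?_⟩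
    omega

/-- **`(y² = x³ + B)^{(d)} = y² = x³ + d³B` on the nose**, integer form of the tree's `quadraticTwist_mk_a₆`.
[cite: SilvermanAEC2009, X.5 Prop. 5.4] -/
theorem quadraticTwist_sextic_intCast (B d : ℤ) :
    (⟨0, 0, 0, 0, (B : ℚ)⟩ : WeierstrassCurve ℚ).quadraticTwist (d : ℚ) = ⟨0, 0, 0, 0, ((d ^ 3 * B : ℤ) : ℚ)⟩ := by
  rw [quadraticTwist_mk_a₆]
  push_cast
  rfl

/-- **The twist model `y² = x³ + d³B` is globally minimal** for `d` square-free with every prime of `d` prime to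
`432B = 2⁴·3³·B`, granted the base criterion `q¹² ∤ 432B²` at every prime.
[cite: SilvermanAEC2009, VII.1 Remark 1.1 and X.5 Prop. 5.4] -/
theorem isGloballyMinimal_sextic_twist (B : ℤ) {d : ℤ} (hsq : Squarefree d.natAbs)
    (hcop : ∀ q : ℕ, q.Prime → q ∣ d.natAbs → ¬ q ∣ (432 * B).natAbs)
    (hbase : ∀ q : ℕ, q.Prime → ¬ (q : ℤ) ^ 12 ∣ 432 * B ^ 2) :
    (⟨0, 0, 0, 0, ((d ^ 3 * B : ℤ) : ℚ)⟩ : WeierstrassCurve ℚ).IsGloballyMinimal :=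
  isGloballyMinimal_sextic_of_criterion (d ^ 3 * B) fun q hq =>
    Or.inl (not_pow_twelve_dvd_mul_sq_twist hsq hq (hcop q hq) (hbase q hq))

/-- **The twist model `y² = x³ + d³·16u` is globally minimal** for `u ≡ 3 (mod 4)`, `d ≡ 1 (mod 4)` square-free
with every prime of `d` prime to `6u`, granted `q¹² ∤ 432(16u)²` at every ODD prime (at `2`:
`ord₂ Δ = 12 + 2·ord₂ u = 12` and Kraus's test decides — the case of `3888s1 = y² = x³ + 48`, Kodaira II* at `2`).
[cite: Kraus1989, Prop. 2] [cite: SilvermanAEC2009, VII.1 Remark 1.1 and X.5 Prop. 5.4] -/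
theorem isGloballyMinimal_sextic_twist_sixteen_mul (u : ℤ) {d : ℤ} (hd4 : d % 4 = 1) (hu : u % 4 = 3)
    (hsq : Squarefree d.natAbs) (hcop : ∀ q : ℕ, q.Prime → q ∣ d.natAbs → ¬ q ∣ (432 * (16 * u)).natAbs)
    (hbase : ∀ q : ℕ, q.Prime → q ≠ 2 → ¬ (q : ℤ) ^ 12 ∣ 432 * (16 * u) ^ 2) :
    (⟨0, 0, 0, 0, ((d ^ 3 * (16 * u) : ℤ) : ℚ)⟩ : WeierstrassCurve ℚ).IsGloballyMinimal :=
  isGloballyMinimal_sextic_of_criterion (d ^ 3 * (16 * u)) fun q hq => by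
    by_cases h2 : q = 2
    · refine Or.inr ⟨h2, d ^ 3 * u, by ring, ?_⟩
      obtain ⟨n, rfl⟩ : ∃ n : ℤ, d = 4 * n + 1 := ⟨d / 4, by omega⟩
      rw [show (4 * n + 1) ^ 3 * u = u + 4 * ((16 * n ^ 3 + 12 * n ^ 2 + 3 * n) * u) by ring,
        Int.add_mul_emod_self_left]
      exact hu
    · exact Or.inl (not_pow_twelve_dvd_mul_sq_twist hsq hq (hcop q hq) (hbase q hq h2))

/-! ## §5 The conclusion ON THE NOSE — `E`-generic and `a`-generic -/

section Generic

variable (W : WeierstrassCurve ℚ) [W.IsElliptic] [W.IsGloballyMinimal] [NeZero (W.conductorNorm ℤ)]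

/-- **`ord_{s=1} L(W₁, s) = 1 ∧ BSD(W₁, 2)` for every globally minimal MODEL `W₁` of `W^{(d)}`
(`C • W^{(d)} = W₁`)**, from a CM base `W` with `N(W) < 5000`, a rational point of infinite order,
`W(ℚ)[2] = 0`, `c₂(W)` odd, an imaginary quadratic `K` with the Heegner hypothesis and a (★)-datum (DISPLAYED
binder `hSD`), `d ∈ 𝒩(W, K)` with `χ_d(−N) = 1` — granted BY NAME the seven facts of p3's transport
(`P2.bsdp_two_of_isIsogenous_twist_of_hasKrizLiStarDatum`, `P2.analyticRank_of_twist_of_hasKrizLiStarDatum`;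
the rank-zero partner `W^{(d·d_K)}` enters through an abstract minimal model, `P2.exists_globallyMinimal_twist`).
[cite: KrizLi2019, Thm. 5.1 (2) and Thm. 4.3 (FMS) = arXiv Thm. 1.12 / 3.3] [cite: CreutzMiller2012, Thm. 1.1]
[cite: BurungaleFlach2024, Thm. 1.1 and Cor. 2] [cite: MilneADT2006, Thm. I.7.3] -/
theorem analyticRank_eq_one_and_bsdp_two_of_smul_twist_of_hasKrizLiStarDatum
    (hKL : KrizLi2019.thm112_bsdTwo_twist) (h33 : KrizLi2019.thm33_rank_twist)
    (hS31 : bsdTriple_of_analyticRank_le_one_of_conductor_lt) (hBF : bsdTriple_of_hasCM_of_L_one_ne_zero)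
    (hmod : hasEntireLFunction_rat) (hGZK : rank_eq_analyticRank_of_analyticRank_le_one)
    (hCassels : bsdRHS_eq_of_isIsogenous) (hcm : W.HasCM) (hN : W.conductorNorm ℤ < 5000)
    (hrk : 1 ≤ W.mordellWeilRank) (h2 : ∀ Q : W.toAffine.Point, 2 • Q = 0 → Q = 0)
    (hc2 : haveI : Fact (2 : ℕ).Prime := ⟨Nat.prime_two⟩; Odd ((W.baseChange ℚ_[2]).localTamagawaNumber ℤ_[2]))
    (K : Type) [Field K] [NumberField K] (hK : IsImaginaryQuadratic K)
    (hH : SatisfiesHeegnerHypothesis (W.conductorNorm ℤ) K) (hSD : HasKrizLiStarDatum W K)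
    {d : ℤ} (hd : KrizLi2019.InN W K d) (hsign : Int.sign d * jacobiSym (W.conductorNorm ℤ) d.natAbs = 1)
    (W₁ : WeierstrassCurve ℚ) [W₁.IsElliptic] [W₁.IsGloballyMinimal] {C : VariableChange ℚ}
    (hC : C • W.quadraticTwist (d : ℚ) = W₁) : W₁.analyticRank = 1 ∧ BSDp W₁ 2 := by
  have hd0 : d ≠ 0 := by have h4 := hd.1; omega
  have hdK : ((d * NumberField.discr K : ℤ) : ℚ) ≠ 0 := by
    exact_mod_cast mul_ne_zero hd0 (NumberField.discr_ne_zero K)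
  obtain ⟨W₂, _, _, hW₂⟩ := P2.exists_globallyMinimal_twist W hdK
  exact ⟨(analyticRank_of_twist_of_hasKrizLiStarDatum W h33 hBF hmod hcm hrk h2 K hK hH hSD hd hsign W₁ W₂
      ⟨C, hC⟩ hW₂).1,
    bsdp_two_of_isIsogenous_twist_of_hasKrizLiStarDatum W hKL h33 hS31 hBF hmod hGZK hCassels hcm hN hrk h2
      hc2 K hK hH hSD hd hsign W₁ (Or.inl (isIsogenous_of_smul_eq' hC))⟩

end Generic

/-- **The `a`-GENERIC conclusion on the nose for `E_a = y² + y = x³ + a`**: for a globally minimal `E_a` with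
`N(E_a) < 5000` and a rational point of infinite order, an imaginary quadratic `K` with the Heegner hypothesis
and a (★)-datum, and `d ∈ 𝒩(E_a, K)` with `χ_d(−N) = 1` whose primes are prime to `27(4a+1)`, granted the
base criterion `q¹² ∤ 27(4a+1)²`: the twist model `E_k`, `4k + 1 = d³(4a + 1)`, is globally minimal with
`ord_{s=1} L(E_k, s) = 1 ∧ BSD(E_k, 2)` BY NAME (seven facts). [cite: KrizLi2019, Thm. 5.1 (2), Thm. 4.3, Def. 4.1]
[cite: SilvermanAEC2009, VII.1 Remark 1.1] [cite: CreutzMiller2012, Thm. 1.1] [cite: BurungaleFlach2024, Cor. 2] -/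
theorem analyticRank_eq_one_and_bsdp_two_cubicA₃_twistModel (a : ℤ) [(cubicA₃ a).IsGloballyMinimal]
    (hKL : KrizLi2019.thm112_bsdTwo_twist) (h33 : KrizLi2019.thm33_rank_twist)
    (hS31 : bsdTriple_of_analyticRank_le_one_of_conductor_lt) (hBF : bsdTriple_of_hasCM_of_L_one_ne_zero)
    (hmod : hasEntireLFunction_rat) (hGZK : rank_eq_analyticRank_of_analyticRank_le_one)
    (hCassels : bsdRHS_eq_of_isIsogenous) (hN : (cubicA₃ a).conductorNorm ℤ < 5000)
    (hrk : 1 ≤ (cubicA₃ a).mordellWeilRank) (K : Type) [Field K] [NumberField K] (hK : IsImaginaryQuadratic K)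
    (hH : SatisfiesHeegnerHypothesis ((cubicA₃ a).conductorNorm ℤ) K) (hSD : HasKrizLiStarDatum (cubicA₃ a) K)
    {d k : ℤ} (hk : 4 * k + 1 = d ^ 3 * (4 * a + 1)) (hd : KrizLi2019.InN (cubicA₃ a) K d)
    (hsign : Int.sign d * jacobiSym ((cubicA₃ a).conductorNorm ℤ) d.natAbs = 1)
    (hcop : ∀ q : ℕ, q.Prime → q ∣ d.natAbs → ¬ q ∣ (27 * (4 * a + 1)).natAbs)
    (hbase : ∀ q : ℕ, q.Prime → ¬ (q : ℤ) ^ 12 ∣ 27 * (4 * a + 1) ^ 2) :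
    ∃ _ : (cubicA₃ k).IsGloballyMinimal, (cubicA₃ k).analyticRank = 1 ∧ BSDp (cubicA₃ k) 2 := by
  haveI hmin := isGloballyMinimal_cubicA₃_twist a hk hd.2.1 hcop hbase
  exact ⟨hmin, analyticRank_eq_one_and_bsdp_two_of_smul_twist_of_hasKrizLiStarDatum (cubicA₃ a) hKL h33 hS31
    hBF hmod hGZK hCassels (hasCM_cubicA₃ a) hN hrk (twoTorsion_cubicA₃ a) (odd_localTamagawaNumber_two_cubicA₃ a)
    K hK hH hSD hd hsign (cubicA₃ k) (smul_quadraticTwist_cubicA₃_eq a hk)⟩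

end Summit.BirchSwinnertonDyer.Rank1Residual.P2

end
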